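import Summits.SmoothPoincare4.SmoothPoincare4.Theorems.SullivanDualTargetHelperSlowStep
import Summits.SmoothPoincare4.SmoothPoincare4.Theorems.SullivanDualTargetHelperCollarFirstOrder
import Summits.SmoothPoincare4.SmoothPoincare4.Theorems.SullivanDualTargetHelperFormGlue
import Summits.SmoothPoincare4.SmoothPoincare4.Theorems.SullivanDualTargetHelperRadialModel
import Summits.SmoothPoincare4.SmoothPoincare4.Theorems.SullivanDualTargetHelperCollarInterpolation
import Summits.SmoothPoincare4.SmoothPoincare4.Theorems.SullivanDualTargetHelperKjCollarMap
import Literature.Geometry.Symplectic.GromovR4StdModel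

/-!
# SmoothPoincare4 / SullivanDual — crux `Target` (stmt-SmoothPoincare4-7823), line `kaehler-jacket`:
# `stub_ballExtension` — cap the puncture `q` by the star-shaped ball (assembly, lead c6)

We prove the registered stub `stub_ballExtension` of the skeleton
`Cruxes/Target/Lines/kaehler_jacket.lean`: given the jacket `F` (a smooth immersion off `q`), the
chart radii `0 < μ < μ'` about `q` (closed `μ'`-ball inside the chart target and missing `p`), a
smooth `u : ℝ⁴ → ℝ`, and the collar `Ψ` of `stub_liouvilleCollar` (a smooth immersion of the
`δ₁`-shell about the chart-sphere `S_μ(q)` with `Ψ*ω₀ = F*ω₀`, equal on the sphere to the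
star-shaped model `θ ↦ e^{u(θ)/2} θ` through `θ = A⁻¹(μ⁻¹(e_q x − c))`, inner side ↦ inside of
the model hypersurface), there is a smooth closed non-degenerate `2`-form on `Σ ∖ p` equal to
`F*ω₀` off the closed chart-ball `{‖e_q x − c‖ ≤ μ}`.

Proof (no collar uniqueness, no isotopy extension): the cap only needs an IMMERSION `Θ` of the
open chart ball `U = {‖e_q x − c‖ < μ(1 + δ₂)}` that agrees with `Ψ` near the sphere; then
`Θ*ω₀` on `U` and `F*ω₀` off `K = {‖e_q x − c‖ ≤ μ}` glue (`helper_formGlue`, p132272).  We take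
`Θ := M₀ ∘ κ' ∘ g ∘ e_q` with `g y = A⁻¹(μ⁻¹(y − c))`, where `κ` is the Euclidean collar map of `Ψ`
(`helper_kjCollarMap`, p132572: smooth immersion on a shell, `= id` on `S³`, inside ↦ inside,
`M_u ∘ κ ∘ g ∘ e_q = Ψ`), `κ'` its log-slow interpolation with the identity
(`helper_collarInterpolation`, p132634, over `helper_collarFirstOrder`, p132336, and
`helper_slowStep`, p132250: an immersion of the ball, `= κ` on an outer collar where also
`‖κ‖ > 1/2`), and `M₀` the radial model made a global immersion (`helper_radialModel`, p132477,
`= M_u` on `‖y‖ ≥ 1/2`).  On the outer collar `Θ = M_u ∘ κ ∘ g ∘ e_q = Ψ`, so `Θ*ω₀ = Ψ*ω₀ = F*ω₀`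
there (locality of `mfderiv`).

References: H. Geiges, *An Introduction to Contact Topology*, CUP 2008, Lemma 1.7.2 (radial
extension over a ball) and Lemma 5.2.4 (collars of star-shaped hypersurfaces) [Geiges2008].
-/

noncomputable section

set_option linter.dupNamespace false

open scoped Manifold ContDiff Topology
open Set Function Filter Metric
open Literature.Geometry.Kaehler (MForm IsSmoothForm IsClosedForm mextDeriv)
open Literature.Geometry.Symplectic (punctured InPuncturedChartBall stdSymplecticForm inversion
  invertedStdForm IsSymplecticStandardNearPoint AgreesWithInvertedChartNear)
open Literature.Topology.FourManifolds (HomotopySphere)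

namespace Summit.SmoothPoincare4.SmoothPoincare4.Theorems.Target.KaehlerJacket

local notation "E4" => EuclideanSpace ℝ (Fin 4)

/-! ## The registered stub -/

/-- **Stub 3 of line `kaehler-jacket` — BALL EXTENSION (cap the puncture `q` by the star-shaped
ball).**  See the skeleton docstring.  Proof: the cap form only needs an IMMERSION `Θ` of the open
chart ball `U = {‖e_q x − c‖ < μ(1 + δ₂)}` agreeing with `Ψ` near the sphere: pull `ω₀` back by
`Θ` on `U` and by `F` off the closed ball `K` and glue (`helper_formGlue`).  `Θ := M₀ ∘ κ' ∘ N`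
with `N x = A⁻¹(μ⁻¹(e_q x − c))` the affine chart normalisation, `κ` the Euclidean collar map of
`Ψ` (`helper_kjCollarMap`: `= id` on `S³`, inside ↦ inside), `κ'` its log-slow interpolation with
the identity (`helper_collarInterpolation` over `helper_collarFirstOrder` and `helper_slowStep`),
and `M₀` the radial star-shaped model made a global immersion (`helper_radialModel`); on the outer
collar `κ' = κ`, `M₀ = M_u`, so `Θ = M_u ∘ κ ∘ N = Ψ` and `Θ*ω₀ = Ψ*ω₀ = F*ω₀` there.
[cite: Geiges2008, Lemma 1.7.2] -/
theorem stub_ballExtension :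
    ∀ (S : HomotopySphere 4) (p q : S.carrier) (F : punctured p → E4) (μ μ' : ℝ)
      (A : E4 ≃ₗᵢ[ℝ] E4) (u : E4 → ℝ) (Ψ : punctured p → E4) (δ₁ : ℝ),
      q ≠ p →
      (∀ x : punctured p, x.1 ≠ q →
        ContMDiffAt (𝓡 4) 𝓘(ℝ, E4) ∞ F x ∧ Injective (mfderiv (𝓡 4) 𝓘(ℝ, E4) F x)) →
      0 < μ → μ < μ' →
      Metric.closedBall (extChartAt (𝓡 4) q q) μ' ⊆ (extChartAt (𝓡 4) q).target →
      (∀ y ∈ Metric.closedBall (extChartAt (𝓡 4) q q) μ', (extChartAt (𝓡 4) q).symm y ≠ p) →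
      ContDiff ℝ ∞ u → 0 < δ₁ →
      (∀ x : punctured p, x.1 ∈ (chartAt E4 q).source →
        |‖extChartAt (𝓡 4) q x.1 - extChartAt (𝓡 4) q q‖ - μ| < δ₁ →
        ContMDiffAt (𝓡 4) 𝓘(ℝ, E4) ∞ Ψ x ∧ Injective (mfderiv (𝓡 4) 𝓘(ℝ, E4) Ψ x)) →
      (∀ x y : punctured p, x.1 ∈ (chartAt E4 q).source →
        |‖extChartAt (𝓡 4) q x.1 - extChartAt (𝓡 4) q q‖ - μ| < δ₁ →
        y.1 ∈ (chartAt E4 q).source →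
        |‖extChartAt (𝓡 4) q y.1 - extChartAt (𝓡 4) q q‖ - μ| < δ₁ → Ψ x = Ψ y → x = y) →
      (∀ x : punctured p, x.1 ∈ (chartAt E4 q).source →
        |‖extChartAt (𝓡 4) q x.1 - extChartAt (𝓡 4) q q‖ - μ| < δ₁ →
        ∀ v w : TangentSpace (𝓡 4) x,
          stdSymplecticForm (mfderiv (𝓡 4) 𝓘(ℝ, E4) Ψ x v) (mfderiv (𝓡 4) 𝓘(ℝ, E4) Ψ x w) =
            stdSymplecticForm (mfderiv (𝓡 4) 𝓘(ℝ, E4) F x v) (mfderiv (𝓡 4) 𝓘(ℝ, E4) F x w)) →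
      (∀ x : punctured p, x.1 ∈ (chartAt E4 q).source →
        ‖extChartAt (𝓡 4) q x.1 - extChartAt (𝓡 4) q q‖ = μ →
        Ψ x = Real.exp (u (A.symm (μ⁻¹ • (extChartAt (𝓡 4) q x.1 - extChartAt (𝓡 4) q q))) / 2) •
          A.symm (μ⁻¹ • (extChartAt (𝓡 4) q x.1 - extChartAt (𝓡 4) q q))) →
      (∀ x : punctured p, x.1 ∈ (chartAt E4 q).source →
        |‖extChartAt (𝓡 4) q x.1 - extChartAt (𝓡 4) q q‖ - μ| < δ₁ →
        (‖extChartAt (𝓡 4) q x.1 - extChartAt (𝓡 4) q q‖ < μ ↔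
          ‖Ψ x‖ < Real.exp (u (‖Ψ x‖⁻¹ • Ψ x) / 2))) →
      ∃ sf : MForm (𝓡 4) (punctured p) ℝ 2,
        IsSmoothForm sf ∧ IsClosedForm sf ∧
        (∀ (x : punctured p) (v : TangentSpace (𝓡 4) x), v ≠ 0 → ∃ w, sf x ![v, w] ≠ 0) ∧
        (∀ x : punctured p,
          ¬ (x.1 ∈ (chartAt E4 q).source ∧ ‖extChartAt (𝓡 4) q x.1 - extChartAt (𝓡 4) q q‖ ≤ μ) →
          ∀ v w : TangentSpace (𝓡 4) x, sf x ![v, w] =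
            stdSymplecticForm (mfderiv (𝓡 4) 𝓘(ℝ, E4) F x v) (mfderiv (𝓡 4) 𝓘(ℝ, E4) F x w)) := by
  intro S p q F μ μ' A u Ψ δ₁ hq hF hμ hμμ' hball havoid hu hδ₁ hΨemb _hΨinj hΨsymp hΨsphere hΨsides
  -- Step 1: the Euclidean collar map of `Ψ`
  obtain ⟨κ, δ, hδpos, hδ1, hδμ, _hδμ', hκsm, hκsph, hκsides, hκlink⟩ :=
    helper_kjCollarMap S p q μ μ' A u Ψ δ₁ hq hμ hμμ' hball havoid hu hδ₁ hΨemb hΨsphere hΨsides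
  -- Step 2: first-order data at the sphere and the interpolation with the identity
  have HFO := helper_collarFirstOrder κ δ hδpos hδ1 hκsm hκsph hκsides
  obtain ⟨κ', δ₂, hδ₂pos, hδ₂lt, hκ'sm, hκ'eq, -, hκnorm⟩ :=
    helper_collarInterpolation κ δ hδpos hδ1 hκsm HFO helper_slowStep
  -- Step 3: the radial model as a global immersion
  obtain ⟨M₀, hM₀sm, hM₀inj, hM₀eq⟩ := helper_radialModel u hu
  -- notation
  set e := extChartAt (𝓡 4) q with he
  set c : E4 := e q with hc
  set xq : punctured p := ⟨q, Literature.Geometry.Symplectic.mem_punctured.2 hq⟩ with hxq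
  set ch := chartAt E4 xq with hch
  have hch_apply : ∀ z : punctured p, ch z = e z.1 := fun z => rfl
  have hch_source : ∀ z : punctured p, z ∈ ch.source ↔ z.1 ∈ (chartAt E4 q).source := fun z => by
    rw [hch, TopologicalSpace.Opens.chartAt_eq, OpenPartialHomeomorph.subtypeRestr_source]
    rfl
  -- the Euclidean part of the cap immersion
  set g : E4 → E4 := fun y => A.symm (μ⁻¹ • (y - c)) with hg
  set G : E4 → E4 := fun y => M₀ (κ' (g y)) with hG
  set Θ : punctured p → E4 := fun x => G (e x.1) with hΘ
  have hnorm_g : ∀ y : E4, ‖g y‖ = μ⁻¹ * ‖y - c‖ := fun y => by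
    simp only [hg]
    rw [LinearIsometryEquiv.norm_map, norm_smul, Real.norm_of_nonneg (inv_nonneg.2 hμ.le)]
  have hg_smooth : ContDiff ℝ ∞ g := by
    have hA : ContDiff ℝ ∞ (fun y : E4 => (A.symm y : E4)) := A.symm.toContinuousLinearEquiv.contDiff
    exact hA.comp ((contDiff_id.sub contDiff_const).const_smul μ⁻¹)
  have hg_deriv : ∀ y : E4,
      HasFDerivAt g (μ⁻¹ • (A.symm.toContinuousLinearEquiv : E4 →L[ℝ] E4)) y := fun y => by
    have h1 : HasFDerivAt (fun y : E4 => (A.symm y : E4))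
        (A.symm.toContinuousLinearEquiv : E4 →L[ℝ] E4) (μ⁻¹ • (y - c)) :=
      A.symm.toContinuousLinearEquiv.hasFDerivAt
    have h2 : HasFDerivAt (fun y : E4 => μ⁻¹ • (y - c)) (μ⁻¹ • ContinuousLinearMap.id ℝ E4) y :=
      ((hasFDerivAt_id y).sub_const c).const_smul μ⁻¹
    have h := h1.comp y h2
    have heq : (A.symm.toContinuousLinearEquiv : E4 →L[ℝ] E4).comp (μ⁻¹ • ContinuousLinearMap.id ℝ E4)
        = μ⁻¹ • (A.symm.toContinuousLinearEquiv : E4 →L[ℝ] E4) := by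
      ext v
      simp
    rw [heq] at h
    exact h
  have hginj : Injective (μ⁻¹ • (A.symm.toContinuousLinearEquiv : E4 →L[ℝ] E4)) := by
    intro v w hvw
    have h' : μ⁻¹ • A.symm v = μ⁻¹ • A.symm w := by simpa using hvw
    exact A.symm.injective (smul_right_injective E4 (inv_ne_zero hμ.ne') h')
  -- smoothness and immersivity of `G` where `‖g y‖ < 1 + δ`
  have hG_at : ∀ y : E4, ‖g y‖ < 1 + δ →
      ContDiffAt ℝ ∞ G y ∧ ∃ L : E4 →L[ℝ] E4, HasFDerivAt G L y ∧ Injective L := fun y hy => by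
    obtain ⟨hκ'y, hκ'inj⟩ := hκ'sm (g y) hy
    have hM₀y : ContDiffAt ℝ ∞ M₀ (κ' (g y)) := hM₀sm.contDiffAt
    refine ⟨hM₀y.comp y (hκ'y.comp y hg_smooth.contDiffAt), ?_⟩
    refine ⟨(fderiv ℝ M₀ (κ' (g y))).comp ((fderiv ℝ κ' (g y)).comp
      (μ⁻¹ • (A.symm.toContinuousLinearEquiv : E4 →L[ℝ] E4))), ?_, ?_⟩
    · exact (hM₀y.differentiableAt (by simp)).hasFDerivAt.comp y
        ((hκ'y.differentiableAt (by simp)).hasFDerivAt.comp y (hg_deriv y))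
    · intro v w hvw
      exact hginj (hκ'inj (hM₀inj _ hvw))
  -- the sets
  set U : Set (punctured p) := {x | x.1 ∈ (chartAt E4 q).source ∧ ‖e x.1 - c‖ < μ * (1 + δ₂)}
    with hU
  set K : Set (punctured p) := {x | x.1 ∈ (chartAt E4 q).source ∧ ‖e x.1 - c‖ ≤ μ} with hK
  have hKU : K ⊆ U := fun x hx => ⟨hx.1, lt_of_le_of_lt hx.2 (by nlinarith)⟩
  have hUopen : IsOpen U := by
    have h : IsOpen (ch.source ∩ ch ⁻¹' Metric.ball c (μ * (1 + δ₂))) :=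
      ch.isOpen_inter_preimage Metric.isOpen_ball
    convert h using 1
    ext x
    simp only [hU, Set.mem_setOf_eq, Set.mem_inter_iff, Set.mem_preimage, Metric.mem_ball,
      dist_eq_norm, hch_source, hch_apply]
  have hKclosed : IsClosed K := by
    have hsub : Metric.closedBall c μ ⊆ e.target :=
      (Metric.closedBall_subset_closedBall hμμ'.le).trans hball
    have hcpt : IsCompact (e.symm '' Metric.closedBall c μ) :=
      (isCompact_closedBall c μ).image_of_continuousOn
        ((continuousOn_extChartAt_symm (I := 𝓡 4) q).mono hsub)
    have hK' : K = Subtype.val ⁻¹' (e.symm '' Metric.closedBall c μ) := by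
      ext x
      simp only [hK, Set.mem_setOf_eq, Set.mem_preimage, Set.mem_image, Metric.mem_closedBall,
        dist_eq_norm]
      constructor
      · rintro ⟨hxs, hxn⟩
        refine ⟨e x.1, hxn, ?_⟩
        exact e.left_inv (by rwa [he, extChartAt_source])
      · rintro ⟨y, hy, hyx⟩
        have hyt : y ∈ e.target := hsub (by rwa [Metric.mem_closedBall, dist_eq_norm])
        have hsrc : e.symm y ∈ (chartAt E4 q).source := by
          rw [← extChartAt_source (I := 𝓡 4)]
          exact e.map_target hyt
        rw [← hyx]
        exact ⟨hsrc, by rw [e.right_inv hyt]; exact hy⟩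
    rw [hK']
    exact hcpt.isClosed.preimage continuous_subtype_val
  -- `Θ` on `U`
  have hΘU : ∀ x ∈ U, ContMDiffAt (𝓡 4) 𝓘(ℝ, E4) ∞ Θ x ∧
      Injective (mfderiv (𝓡 4) 𝓘(ℝ, E4) Θ x) := fun x hx => by
    have hxs : x ∈ ch.source := (hch_source x).2 hx.1
    have hgy : ‖g (e x.1)‖ < 1 + δ := by
      rw [hnorm_g]
      have : μ⁻¹ * ‖e x.1 - c‖ < 1 + δ₂ := by
        rw [inv_mul_lt_iff₀ hμ]
        exact hx.2
      linarith
    obtain ⟨hGsm, L, hGL, hLinj⟩ := hG_at (e x.1) hgy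
    have hch_sm : ContMDiffAt (𝓡 4) 𝓘(ℝ, E4) ∞ ch x :=
      (contMDiffOn_chart (x := xq)).contMDiffAt (ch.open_source.mem_nhds hxs)
    have hcomp : Θ = G ∘ ch := rfl
    refine ⟨?_, ?_⟩
    · rw [hcomp]
      exact (contMDiffAt_iff_contDiffAt.2 hGsm).comp x hch_sm
    · have hch_d : HasMFDerivAt (𝓡 4) 𝓘(ℝ, E4) ch x (mfderiv (𝓡 4) 𝓘(ℝ, E4) ch x) :=
        ((mdifferentiable_chart xq).mdifferentiableAt hxs).hasMFDerivAt
      have hΘd : HasMFDerivAt (𝓡 4) 𝓘(ℝ, E4) Θ x (L.comp (mfderiv (𝓡 4) 𝓘(ℝ, E4) ch x)) := by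
        rw [hcomp]
        exact hGL.hasMFDerivAt.comp x hch_d
      rw [hΘd.mfderiv]
      intro v w hvw
      exact (mdifferentiable_chart xq).mfderiv_injective hxs (hLinj hvw)
  -- `F` off `K`
  have hFK : ∀ x : punctured p, x ∉ K → ContMDiffAt (𝓡 4) 𝓘(ℝ, E4) ∞ F x ∧
      Injective (mfderiv (𝓡 4) 𝓘(ℝ, E4) F x) := fun x hx => by
    refine hF x ?_
    intro hxq
    apply hx
    refine ⟨by rw [hxq]; exact mem_chart_source E4 q, ?_⟩
    rw [hxq]
    simp [hc, hμ.le]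
  -- agreement `Θ*ω₀ = F*ω₀` on `U ∖ K`
  set W : Set (punctured p) := {x | x.1 ∈ (chartAt E4 q).source ∧
      ‖e x.1 - c‖ ∈ Set.Ioo (μ * (1 - δ₂)) (μ * (1 + δ₂))} with hW
  have hWopen : IsOpen W := by
    have h : IsOpen (ch.source ∩ ch ⁻¹' ((fun y : E4 => ‖y - c‖) ⁻¹' Set.Ioo (μ * (1 - δ₂)) (μ * (1 + δ₂)))) :=
      ch.isOpen_inter_preimage ((continuous_norm.comp (continuous_id.sub continuous_const)).isOpen_preimage _ isOpen_Ioo)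
    convert h using 1
    ext x
    simp only [hW, Set.mem_setOf_eq, Set.mem_inter_iff, Set.mem_preimage, hch_source, hch_apply]
  have hΘW : ∀ x ∈ W, Θ x = Ψ x := fun x hx => by
    have hy1 : 1 - δ₂ < ‖g (e x.1)‖ := by
      rw [hnorm_g, lt_inv_mul_iff₀ hμ]
      exact hx.2.1
    have hy2 : ‖g (e x.1)‖ < 1 + δ₂ := by
      rw [hnorm_g, inv_mul_lt_iff₀ hμ]
      exact hx.2.2
    have h1 : κ' (g (e x.1)) = κ (g (e x.1)) := hκ'eq _ hy1
    have h2 : (1 : ℝ) / 2 ≤ ‖κ (g (e x.1))‖ := (hκnorm _ hy1 hy2).le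
    show M₀ (κ' (g (e x.1))) = Ψ x
    rw [h1, hM₀eq _ h2]
    exact hκlink x hx.1
  have hagree : ∀ x ∈ U, x ∉ K → ∀ v w : TangentSpace (𝓡 4) x,
      stdSymplecticForm (mfderiv (𝓡 4) 𝓘(ℝ, E4) Θ x v) (mfderiv (𝓡 4) 𝓘(ℝ, E4) Θ x w) =
        stdSymplecticForm (mfderiv (𝓡 4) 𝓘(ℝ, E4) F x v) (mfderiv (𝓡 4) 𝓘(ℝ, E4) F x w) :=
    fun x hxU hxK v w => by
    have hgt : μ < ‖e x.1 - c‖ := by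
      by_contra h
      exact hxK ⟨hxU.1, not_lt.1 h⟩
    have hxW : x ∈ W := ⟨hxU.1, ⟨by nlinarith, hxU.2⟩⟩
    have hev : Θ =ᶠ[𝓝 x] Ψ :=
      Filter.eventuallyEq_of_mem (hWopen.mem_nhds hxW) fun z hz => hΘW z hz
    rw [hev.mfderiv_eq]
    have hshell : |‖e x.1 - c‖ - μ| < δ₁ := by
      rw [abs_lt]
      constructor
      · linarith
      · have : ‖e x.1 - c‖ - μ < μ * δ₂ := by linarith [hxU.2]
        have : μ * δ₂ < μ * δ := by gcongr
        linarith
    exact hΨsymp x hxU.1 hshell v w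
  -- Step 5: glue
  obtain ⟨sf, hs, hcl, hnd, hoff⟩ := helper_formGlue S p U K Θ F hUopen hKclosed hKU hΘU hFK hagree
  exact ⟨sf, hs, hcl, hnd, fun x hx v w => hoff x hx v w⟩

end Summit.SmoothPoincare4.SmoothPoincare4.Theorems.Target.KaehlerJacket

end
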